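import Literature.MathematicalPhysics.QuantumFieldTheory.Balaban1983to89.B2Eq341Zeta

/-!
# `Balaban1983to89.B2Eq334ZetaPrimeKnit` — [Balaban1982Higgs2] (3.34) p. 591: r14's TYPED ζ′_{Λ₀⁽ᵏ⁾}
(`B2Eq341Zeta.zeta334`, a sum over the minimal admissible tuples of per-element factors) REWRITTEN as the family sum
`Σ_τ w_τ · e^{−¼γ₀p(Lᵏε)²|Q_s⁽ᵏ⁾(τ)|} · (e^{−⅛ap(Lᵏε)²})^{|P_s⁽ᵏ⁾(τ)|}` with `w_τ = χᶜ_{P_v}χᶜ_{Q_v}χᶜ_{R_v}·(e^{−p(Lᵏε)²})^{|R_s⁽ᵏ⁾(τ)|}`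
— the shape in which ζ′ comes out of this seat's (3.22) ⇒ (3.35) theorems (`B2Ineq335Exceptions.rhs322_le`,
`B2Ineq335Printed.ineq335`: level factor `Σ_τ w_{j,τ}σ_{j,τ}θ_{j,τ}`), so that the ζ′ there IS (3.34) BY NAME; a pure
finite-sum identity (theorems only)

statement-level skeleton of published theorems with citation tags; proofs where landed; nothing here is a claim about the Yang–Mills mass gap

CITATION HEADER.  T. Bałaban, *(Higgs)₂,₃ quantum fields in a finite volume. II. An upper bound*, Commun. Math. Phys.
**86** (1982) 555–594 [Balaban1982Higgs2] (cell paper B2; PDF held `paper:balaban1982-cmp86-higgs23-ii`, journal page =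
PDF page + 554; p. 591 read on the ×2 render `…/1982-cmp86-higgs23-II-p037-x2.png`).  Unit `lit-balaban-p15` gen 6
(Phase-2 proof seat p15; HOME `run/shared/lean/pub/lit-balaban/`).  SKELETON row **B2.Eq3.32** member (3.34) (typed
with body by r14 g3 `B2Eq341Zeta.zeta334`, p246287; fold owner r02).  USED BY NAME: r14's `zeta334`, `weight334`,
`weight341`, `sortCard`, `prod_weight341`, `B2Sect3C.term341`, `B2Eq29Resummation.minimals`.  Nothing restated.

THE SOURCE TEXT (verbatim, p. 591): *"Thus, defining the functions ζ′_{Λ₀⁽ᵏ⁾} = Σ_{{P_v⁽ᵏ⁾,…,R_s⁽ᵏ⁾} admissible, minimal}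
χᶜ_{P_v⁽ᵏ⁾}·χᶜ_{Q_v⁽ᵏ⁾}χᶜ_{R_v⁽ᵏ⁾} exp(−⅛ap(Lᵏε)²|P_s⁽ᵏ⁾|)·exp(−¼γ₀p(Lᵏε)²|Q_s⁽ᵏ⁾|) exp(−p(Lᵏε)²|R_s⁽ᵏ⁾|), (3.34) we get the
inequality (3.35)"*.

DICTIONARY (r14's, `B2Eq341Zeta`/`B2Eq29Resummation`): a tuple `τ : Finset S` of elements with `sort x : Fin 6` (0 P_v,
1 Q_v, 2 R_v, 3 P_s, 4 Q_s, 5 R_s), `minimals N W` the minimal admissible tuples for `W = Λ₀⁽ᵏ⁾ᶜ`, `c x` the indicator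
`χᶜ_x` of a vector-sort element, `pk` ↤ `p(Lᵏε)`; `sortCard sort τ σ` = `|P_v⁽ᵏ⁾|, …, |R_s⁽ᵏ⁾|`.  In this seat's
`B2Ineq335Printed.ineq335` the families of level j are any finite type: take `ι j := ↥(minimals N_j W_j)`, `w_{j,τ} :=`
the weight below, `Q_s⁽ʲ⁾(τ)` resp. `P_s⁽ʲ⁾(τ)` := the elements of sort 4 resp. 3 (read as bonds of `Λ_j` resp. output
sites through the injections of the concrete dictionary, so that `|Q_s⁽ʲ⁾(τ)| = sortCard τ 4`, `|P_s⁽ʲ⁾(τ)| = sortCard τ 3`),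
`r_j := p(Lʲε)²`.

WHAT IS PROVED.  `prod_weight334_split` (vector-sort indicators × scalar-sort small factors), `sortCard_scalarPart_of_lt`
/ `_of_not_lt`, **`zeta334_eq_familySum`**: `zeta334 N W sort c a γ₀ pk = Σ_{τ ∈ minimals N W} [(Π_{x∈τ, vector sort} c x)·
(e^{−pk²})^{#R_s(τ)}] · e^{−¼γ₀pk²·#Q_s(τ)} · (e^{−⅛a pk²})^{#P_s(τ)}`, and `zeta334_eq_familySum_subtype` (the same as a sum
over the finite TYPE of minimal admissible tuples, the index type of `ineq335`).  HONEST SCOPE: an identity of finite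
sums; which lattice objects the elements of sorts 3/4 are (output sites / bonds of `Λ_k`) is the concrete dictionary,
as in `B2Eq341Zeta`.
-/

namespace Literature.MathematicalPhysics.QuantumFieldTheory.Balaban1983to89.B2Eq334ZetaPrimeKnit

open Finset
open scoped Classical
open B2Eq29Resummation B2Eq341Zeta

noncomputable section

variable {S β : Type*}

/-- A summand of (3.34) splits into the vector-sort indicators `χᶜ_{P_v}χᶜ_{Q_v}χᶜ_{R_v}` and the scalar-sort small
factors (the latter are the factors of (3.41)). [cite: Balaban1982Higgs2, (3.34) p.591] -/
theorem prod_weight334_split (sort : S → Fin 6) (c : S → ℝ) (a γ₀ pk : ℝ) (τ : Finset S) :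
    ∏ x ∈ τ, weight334 sort c a γ₀ pk x
      = (∏ x ∈ τ.filter (fun x => (sort x : ℕ) < 3), c x)
        * ∏ x ∈ τ.filter (fun x => ¬ (sort x : ℕ) < 3), weight341 sort a γ₀ pk x := by
  rw [← Finset.prod_filter_mul_prod_filter_not τ (fun x => (sort x : ℕ) < 3)]
  congr 1
  · exact Finset.prod_congr rfl fun x hx => by rw [weight334, if_pos (Finset.mem_filter.1 hx).2]
  · exact Finset.prod_congr rfl fun x hx => by rw [weight334, if_neg (Finset.mem_filter.1 hx).2, weight341]

/-- the scalar part of a tuple has no elements of the vector sorts. [cite: Balaban1982Higgs2, (3.34) p.591] -/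
theorem sortCard_scalarPart_of_lt (sort : S → Fin 6) (τ : Finset S) {σ : Fin 6} (hσ : (σ : ℕ) < 3) :
    sortCard sort (τ.filter fun x => ¬ (sort x : ℕ) < 3) σ = 0 := by
  unfold sortCard
  rw [Finset.card_eq_zero, Finset.filter_eq_empty_iff]
  intro x hx h
  exact (Finset.mem_filter.1 hx).2 (h ▸ hσ)

/-- the scalar part of a tuple has the same scalar-sort counts `|P_s|, |Q_s|, |R_s|`. [cite: Balaban1982Higgs2, (3.34) p.591] -/
theorem sortCard_scalarPart_of_not_lt (sort : S → Fin 6) (τ : Finset S) {σ : Fin 6} (hσ : ¬ (σ : ℕ) < 3) :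
    sortCard sort (τ.filter fun x => ¬ (sort x : ℕ) < 3) σ = sortCard sort τ σ := by
  unfold sortCard
  congr 1
  ext x
  simp only [Finset.mem_filter]
  constructor
  · rintro ⟨⟨hx, _⟩, h⟩
    exact ⟨hx, h⟩
  · rintro ⟨hx, h⟩
    exact ⟨⟨hx, by rw [h]; exact hσ⟩, h⟩

variable [Fintype S]

/-- **ζ′ (3.34) AS A FAMILY SUM**: `ζ′_{Λ₀⁽ᵏ⁾} = Σ_{τ admissible minimal} w_τ · e^{−¼γ₀p²|Q_s⁽ᵏ⁾(τ)|} · (e^{−⅛ap²})^{|P_s⁽ᵏ⁾(τ)|}`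
with `w_τ = (Π_{vector-sort x ∈ τ} χᶜ_x) · (e^{−p²})^{|R_s⁽ᵏ⁾(τ)|}` — the level factor `Σ_τ w_{j,τ}σ_{j,τ}θ_{j,τ}` of
`B2Ineq335Exceptions.rhs322_le` / `B2Ineq335Printed.ineq335` (`σ = e^{−¼γ₀r|Q_s|}`, `θ = (e^{−⅛ar})^{|P_s|}`, `r = p(Lᵏε)²`)
for r14's typed ζ′. [cite: Balaban1982Higgs2, (3.34) p.591] -/
theorem zeta334_eq_familySum (N : S → Finset β) (W : Finset β) (sort : S → Fin 6) (c : S → ℝ) (a γ₀ pk : ℝ) :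
    zeta334 N W sort c a γ₀ pk
      = ∑ τ ∈ minimals N W,
          ((∏ x ∈ τ.filter (fun x => (sort x : ℕ) < 3), c x) * Real.exp (-(pk ^ 2)) ^ sortCard sort τ 5)
          * Real.exp (-(γ₀ * pk ^ 2 * (sortCard sort τ 4 : ℕ) / 4))
          * Real.exp (-(a * pk ^ 2 / 8)) ^ sortCard sort τ 3 := by
  unfold zeta334
  refine Finset.sum_congr rfl fun τ _ => ?_
  rw [prod_weight334_split, prod_weight341,
    sortCard_scalarPart_of_lt sort τ (σ := 0) (by decide), sortCard_scalarPart_of_lt sort τ (σ := 1) (by decide),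
    sortCard_scalarPart_of_lt sort τ (σ := 2) (by decide),
    sortCard_scalarPart_of_not_lt sort τ (σ := 3) (by decide), sortCard_scalarPart_of_not_lt sort τ (σ := 4) (by decide),
    sortCard_scalarPart_of_not_lt sort τ (σ := 5) (by decide)]
  simp only [B2Sect3C.term341, Nat.cast_zero, mul_zero, Real.exp_zero, one_mul]
  have h3 : Real.exp (-(a / 8) * pk ^ 2 * (sortCard sort τ 3 : ℕ))
      = Real.exp (-(a * pk ^ 2 / 8)) ^ sortCard sort τ 3 := by
    rw [← Real.exp_nat_mul]; congr 1; ring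
  have h5 : Real.exp (-pk ^ 2 * (sortCard sort τ 5 : ℕ)) = Real.exp (-(pk ^ 2)) ^ sortCard sort τ 5 := by
    rw [← Real.exp_nat_mul]; congr 1; ring
  have h4 : Real.exp (-(γ₀ / 4) * pk ^ 2 * (sortCard sort τ 4 : ℕ))
      = Real.exp (-(γ₀ * pk ^ 2 * (sortCard sort τ 4 : ℕ) / 4)) := by
    congr 1; ring
  rw [h3, h4, h5]
  ring

/-- The same over the finite TYPE of minimal admissible tuples — the family index type `ι j := ↥(minimals N_j W_j)` of
`B2Ineq335Printed.ineq335`. [cite: Balaban1982Higgs2, (3.34) p.591] -/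
theorem zeta334_eq_familySum_subtype (N : S → Finset β) (W : Finset β) (sort : S → Fin 6) (c : S → ℝ)
    (a γ₀ pk : ℝ) :
    zeta334 N W sort c a γ₀ pk
      = ∑ τ : ↥(minimals N W),
          ((∏ x ∈ τ.1.filter (fun x => (sort x : ℕ) < 3), c x) * Real.exp (-(pk ^ 2)) ^ sortCard sort τ.1 5)
          * Real.exp (-(γ₀ * pk ^ 2 * (sortCard sort τ.1 4 : ℕ) / 4))
          * Real.exp (-(a * pk ^ 2 / 8)) ^ sortCard sort τ.1 3 := by
  rw [zeta334_eq_familySum, ← Finset.sum_coe_sort]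

end

end Literature.MathematicalPhysics.QuantumFieldTheory.Balaban1983to89.B2Eq334ZetaPrimeKnit
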